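/-
HONEST FRAMING: certified error envelopes and provably optimal rounding/accumulation schemes for
low-precision formats under stated cost models; every table by two implementations; no hardware
or vendor claims.
-/
import Summits.Ventures.CertifiedArithmetic.LowPrec.OptDemotionRoutingPhiLevel

/-!
# The demotion law (Theorem T8), part 12-3: the `E`-rows `E(S; h, ρ)` AT EVERY LEVEL AND WEIGHT, every configuration, every `q`

Part 11-5 (`treeBR_eRow_all`, the top-level e-side at `ρ = u`) generalised to an arbitrary position
`h ≥ -q` of the 'half' bit and every weight `0 ≤ ρ ≤ 2^h`:

  `E(S; h, ρ):  2·BR_t({-1} ∪ S) ≤ (1-ρ)·BR_t({0} ∪ S) + (1+ρ)·BR_t({h} ∪ S)`,   `S ≠ ∅ ⊆ [h+1, -2]`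

(`treeBR_eRow_level`).  With `h = -(k+2)` and the bits of `B` this is, by value, opt's row
`E(2^k, B, ρ)` of the LEVEL `k` for every weight `ρ ≤ 2^-(k+2)` (part 12-4) — the top level
`k = q-2` at `ρ = u` is Part 11, and the lower levels get their OWN, much larger, weight (the
`B = 0` threshold is `1/(2^(k+2) - 1)`, part 10e `eRow_zero`), which is what the o-side of the split
needs there (opt R22: `ρ_β > u` below `β = 2^(q-1)/8`).  PROOF: the node step of part 11-5 verbatim
with the hand-certified branch lemmas of part 12-1 (`eRowL_all/empty/top/low`; `Φ(K; max S, h, ρ)`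
from part 12-2); no base case is needed (a single bit is covered by the branches `K = S`, `K = ∅`),
so R31 (part 10c) is the instance `|S| = 1`, `h = -q`, `ρ = u`.  Exact LP cross-check of every
branch, `|S| ≤ 3`, `q ≤ 9`, every `h`, `ρ = 2^h`: sessions work/o2/cert_level.py (0 open).
-/

namespace Summit.Ventures.CertifiedArithmetic.LowPrec.Opt

open Literature.ComputerArithmetic.JeannerodRump2018
open Literature.ComputerArithmetic.JeannerodRump2018.SumTree

section ELevel

variable {q : ℕ}

/-- **THE `E`-ROWS AT EVERY LEVEL AND WEIGHT**: for `-q ≤ h`, `0 ≤ ρ ≤ 2^h`, a nonempty set `S` of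
exponents in `[h+1, -2]` and every tree, `2·BR({-1} ∪ S) ≤ (1-ρ)·BR({0} ∪ S) + (1+ρ)·BR({h} ∪ S)`. -/
theorem treeBR_eRow_level (S : Finset ℤ) :
    ∀ (h : ℤ) (ρ : ℚ), -(q : ℤ) ≤ h → 0 ≤ ρ → ρ ≤ (2 : ℚ) ^ h → (∀ s ∈ S, h + 1 ≤ s ∧ s ≤ -2) →
      S.Nonempty → ∀ t : SumTree,
      2 * treeBR q t (insert (-1) S) ≤
        (1 - ρ) * treeBR q t (insert 0 S) + (1 + ρ) * treeBR q t (insert h S) := by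
  classical
  induction S using Finset.strongInduction with
  | H S ihS =>
  intro h ρ hh hρ0 hρ hS hne
  ------------------------------------------------------------------ the top of `S` and the scalars
  obtain ⟨s₁, hs₁S, hs₁max⟩ : ∃ s₁ ∈ S, ∀ s ∈ S, s ≤ s₁ :=
    ⟨S.max' hne, Finset.max'_mem _ _, fun s hs => Finset.le_max' _ _ hs⟩
  have hs₁ := hS s₁ hs₁S
  have hq1 : 1 ≤ q := by omega
  have hS' : ∀ s ∈ S, 1 - (q : ℤ) ≤ s ∧ s ≤ -2 := fun s hs => by have := hS s hs; omega
  set u := unitRoundoff q with hudef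
  set t : ℚ := (2 : ℚ) ^ s₁ with htdef
  set η : ℚ := (2 : ℚ) ^ h with hηdef
  have huz : u = (2 : ℚ) ^ (-(q : ℤ)) := unitRoundoff_eq_zpow q
  have hu0 : 0 < u := by rw [huz]; exact zpow_pos (by norm_num) _
  have hu1 : u ≤ 1 := unitRoundoff_le_one q
  have ht0 : 0 < t := zpow_pos (by norm_num) _
  have hη0 : 0 < η := zpow_pos (by norm_num) _
  have pw : ∀ a b : ℤ, (2 : ℚ) ^ (a + b) = (2 : ℚ) ^ a * (2 : ℚ) ^ b := fun a b =>
    zpow_add₀ (by norm_num) a b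
  have two_mul_zpow : ∀ x : ℤ, (2 : ℚ) * (2 : ℚ) ^ x = (2 : ℚ) ^ (x + 1) := fun x => by
    rw [zpow_add_one₀ (by norm_num)]; ring
  have hηt : 2 * η ≤ t := by
    rw [hηdef, htdef, two_mul_zpow]; exact zpow_le_zpow_right₀ (by norm_num) (by omega)
  have ht4 : t ≤ 1 / 4 := by
    rw [htdef, show (1 / 4 : ℚ) = (2 : ℚ) ^ (-2 : ℤ) by norm_num]
    exact zpow_le_zpow_right₀ (by norm_num) hs₁.2
  have hρ1 : ρ ≤ 1 := by linarith
  have hs : ρ ≤ t + ρ * t := by nlinarith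
  have hρη : ρ ≤ η + ρ * t * u := by nlinarith [mul_nonneg (mul_nonneg hρ0 ht0.le) hu0.le]
  have p_half : (2 : ℚ) ^ (-1 : ℤ) = 1 / 2 := by norm_num
  have p_m1q : (2 : ℚ) ^ (-1 - (q : ℤ)) = u / 2 := by
    rw [huz, show -1 - (q : ℤ) = -(q : ℤ) + -1 by ring, pw]; norm_num; ring
  have p_s₁q : (2 : ℚ) ^ (s₁ - (q : ℤ)) = t * u := by rw [huz, htdef, sub_eq_add_neg, pw]
  have n0 : ∀ (X : SumTree) (T : Finset ℤ), 0 ≤ treeBR q X T := fun X T => treeBR_nonneg q X T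
  have hnq : -(q : ℤ) ∉ S := fun h' => by have := hS' _ h'; omega
  have hnh : h ∉ S := fun h' => by have := hS _ h'; omega
  -- (M) by value: `BR({-q} ∪ C) ≤ BR({h} ∪ C)` for `C ⊆ S`
  have rowQH : ∀ (Y : SumTree) (C : Finset ℤ), C ⊆ S →
      treeBR q Y (insert (-(q : ℤ)) C) ≤ treeBR q Y (insert h C) := by
    intro Y C hC
    have hCb : ∀ c ∈ C, h + 1 ≤ c ∧ c ≤ -2 := fun c hc => hS c (hC hc)
    have hqC : -(q : ℤ) ∉ C := fun h' => hnq (hC h')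
    have hhC : h ∉ C := fun h' => hnh (hC h')
    refine treeBR_mono hq1 Y (Finset.insert_nonempty _ _) (Finset.insert_nonempty _ _) ?_ ?_ ?_
    · refine routable_of_bounds (lo := -(q : ℤ)) (hi := -(q : ℤ) + ((q : ℤ) - 1)) (fun s hs => ?_) le_rfl
      rcases Finset.mem_insert.1 hs with rfl | hs
      · omega
      · have := hCb s hs; omega
    · refine routable_of_bounds (lo := h) (hi := h + ((q : ℤ) - 1)) (fun s hs => ?_) le_rfl
      rcases Finset.mem_insert.1 hs with rfl | hs
      · omega
      · have := hCb s hs; omega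
    · rw [val_insert hqC, val_insert hhC]
      have : (2 : ℚ) ^ (-(q : ℤ)) ≤ (2 : ℚ) ^ h := zpow_le_zpow_right₀ (by norm_num) hh
      linarith
  ------------------------------------------------------------------ the tree induction
  intro tr
  induction tr with
  | leaf z => simp [treeBR]
  | node A B ihA ihB =>
  set NS := treeBR q (.node A B) (insert 0 S) with hNS
  set NR := treeBR q (.node A B) (insert h S) with hNR
  set TR : Finset ℤ := insert h (S.erase s₁) with hTR
  have hTRtop : insert s₁ TR = insert h S := (insert_negq_eq S hs₁S _).symm
  have hS0 : ∀ x ∈ S, (0 : ℤ) + 1 - (q : ℤ) ≤ x ∧ x + 1 ≤ 0 := fun x hx => by have := hS' x hx; omega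
  have hSm1 : ∀ x ∈ S, (-1 : ℤ) + 1 - (q : ℤ) ≤ x ∧ x + 1 ≤ -1 := fun x hx => by have := hS' x hx; omega
  have hTRb : ∀ x ∈ TR, s₁ + 1 - (q : ℤ) ≤ x ∧ x + 1 ≤ s₁ := by
    intro x hx
    rcases Finset.mem_insert.1 hx with rfl | hx
    · omega
    have hx' := Finset.mem_erase.1 hx
    have := hS x hx'.2
    have := hs₁max x hx'.2
    omega
  -- the injected options of the two right-hand coordinates (both orientations)
  have oS : ∀ (X Y : SumTree), treeBR q (.node X Y) (insert 0 S) = NS → ∀ P, P ⊆ S →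
      1 + (treeBR q X (insert 0 P) + treeBR q Y (insert (-(q : ℤ)) (S \ P))) ≤ NS := by
    intro X Y hN P hP
    have h0 := injected_le_treeBR_node_top hq1 X Y (e₀ := 0) (T := S) hS0 hP
    rw [zpow_zero, zero_sub, hN] at h0
    exact h0
  have oR : ∀ (X Y : SumTree), treeBR q (.node X Y) (insert s₁ TR) = NR → ∀ P, P ⊆ TR →
      t + (treeBR q X (insert s₁ P) + treeBR q Y (insert (s₁ - q) (TR \ P))) ≤ NR := by
    intro X Y hN P hP
    have h0 := injected_le_treeBR_node_top hq1 X Y (e₀ := s₁) (T := TR) hTRb hP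
    rw [hN] at h0
    exact h0
  have oSab := oS A B rfl
  have oSba := oS B A (treeBR_node_comm A B _)
  have oRab := oR A B (by rw [hTRtop])
  have oRba := oR B A (by rw [hTRtop, treeBR_node_comm])
  -- the bound `R` on the options of the left coordinate
  set R : ℚ := ((1 - ρ) * NS + (1 + ρ) * NR - 1) / 2 with hRdef
  have hNS1 : 1 ≤ NS := by
    have h0 := oSab S subset_rfl
    linarith only [h0, n0 A (insert 0 S), n0 B (insert (-(q : ℤ)) (S \ S))]
  have hNRt : t ≤ NR := by
    have h0 := oRab TR subset_rfl
    linarith only [h0, n0 A (insert s₁ TR), n0 B (insert (s₁ - q) (TR \ TR))]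
  have hR : 0 ≤ R := by
    rw [hRdef]
    have h1 : (1 - ρ) * 1 ≤ (1 - ρ) * NS := mul_le_mul_of_nonneg_left hNS1 (by linarith only [hρ1])
    have h2 : (1 + ρ) * t ≤ (1 + ρ) * NR := mul_le_mul_of_nonneg_left hNRt (by linarith only [hρ0])
    have : 0 ≤ (1 - ρ) * NS + (1 + ρ) * NR - 1 := by nlinarith only [h1, h2, hs, hρ0]
    linarith only [this]
  ------------------------------------------------------------------ the branch analysis (one orientation)
  have core : ∀ (X Y : SumTree),
      2 * treeBR q X (insert (-1) S) ≤ (1 - ρ) * treeBR q X (insert 0 S) +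
          (1 + ρ) * treeBR q X (insert h S) →
      (∀ P, P ⊆ S → 1 + (treeBR q X (insert 0 P) + treeBR q Y (insert (-(q : ℤ)) (S \ P))) ≤ NS) →
      (∀ P, P ⊆ TR → t + (treeBR q X (insert s₁ P) + treeBR q Y (insert (s₁ - q) (TR \ P))) ≤ NR) →
      (∀ P, P ⊆ TR → t + (treeBR q Y (insert s₁ P) + treeBR q X (insert (s₁ - q) (TR \ P))) ≤ NR) →
      ∀ P, P ⊆ S → treeBR q X (insert (-1) P) + treeBR q Y (insert (-1 - (q : ℤ)) (S \ P)) ≤ R := by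
    intro X Y ihX oS1 oRxy oRyx P hP
    rw [hRdef]
    by_cases hPS : P = S
    · ---------------------------------------------------------------- branch `K = S`
      subst hPS
      have o1 := oS1 P subset_rfl
      have o2' := oRxy TR subset_rfl
      rw [Finset.sdiff_self, Finset.insert_empty, treeBR_single_shift, ← huz] at o1
      rw [Finset.sdiff_self, Finset.insert_empty, treeBR_single_shift, p_s₁q, hTRtop] at o2'
      rw [Finset.sdiff_self, Finset.insert_empty, treeBR_single_shift, p_m1q]
      have b := eRowL_all hρ0 hρ1 hu0.le hs o1 o2' ihX (n0 Y {0})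
      linarith only [b]
    by_cases hP0 : P = ∅
    · ---------------------------------------------------------------- branch `K = ∅`
      subst hP0
      have o1 := oS1 ∅ (Finset.empty_subset _)
      rw [Finset.insert_empty, Finset.sdiff_empty] at o1
      -- `Y` keeps `S ∖ s₁` (and the top `s₁`), `X` gets `{s₁-q, h}`
      have o2' := oRyx (S.erase s₁) (by rw [hTR]; exact Finset.subset_insert _ _)
      have e2 : TR \ S.erase s₁ = {h} := by
        rw [hTR]
        have h2 : h ∉ S.erase s₁ := fun h' => hnh (Finset.mem_erase.1 h').2
        rw [Finset.insert_sdiff_of_notMem _ h2, Finset.sdiff_self]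
        rfl
      have e0s : treeBR q X (insert (s₁ - q) ({h} : Finset ℤ)) = η * treeBR q X {s₁ - q - h, 0} := by
        have : (insert (s₁ - q) ({h} : Finset ℤ)) = {s₁ - q - h + h, 0 + h} := by
          ext z; simp only [Finset.mem_insert, Finset.mem_singleton]; omega
        rw [this, treeBR_pair_shift']
      rw [Finset.insert_erase hs₁S, e2, e0s] at o2'
      -- `Y` keeps everything, `X` gets `{s₁-q}`
      have o3' := oRyx TR subset_rfl
      rw [Finset.sdiff_self, Finset.insert_empty, treeBR_single_shift, p_s₁q, hTRtop] at o3'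
      -- rows: (M) on `X`, (MC) at `{-1-q} ∪ S` and (M) `BR({-q} ∪ S) ≤ BR({h} ∪ S)` on `Y`
      have rMa : treeBR q X {0} ≤ treeBR q X {s₁ - q - h, 0} :=
        treeBR_le_of_subset_of_bounds hq1 X (lo := 1 - (q : ℤ)) (by intro z hz; simp at hz ⊢; omega)
          (by intro z hz; simp only [Finset.mem_insert, Finset.mem_singleton] at hz; omega)
      have rMC := two_treeBR_insert_le hq1 Y (C := S) (i := -1 - (q : ℤ))
        (fun c hc => by have := hS' c hc; omega)
      rw [show (-1 - (q : ℤ)) + 1 = -(q : ℤ) by ring] at rMC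
      have rMb := rowQH Y S subset_rfl
      rw [Finset.insert_empty, Finset.sdiff_empty, treeBR_single_shift, p_half]
      have b := eRowL_empty hρ0 hρ1 hη0.le hs hρη (n0 X {0}) o1 o2' o3' rMa rMC rMb
      linarith only [b]
    ---------------------------------------------------------------- `∅ ≠ K ≠ S`
    have hPne : P.Nonempty := Finset.nonempty_iff_ne_empty.2 hP0
    have hPS' : P ⊂ S := Finset.ssubset_iff_subset_ne.2 ⟨hP, hPS⟩
    have hPb : ∀ s ∈ P, h + 1 ≤ s ∧ s ≤ -2 := fun s hs => hS s (hP hs)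
    have hCb : ∀ c ∈ S \ P, 1 - (q : ℤ) ≤ c ∧ c ≤ -2 := fun c hc => hS' c (Finset.mem_sdiff.1 hc).1
    -- (MC) below the complement, on `Y`
    have rMC := two_treeBR_insert_le hq1 Y (C := S \ P) (i := -1 - (q : ℤ))
      (fun c hc => by have := hCb c hc; omega)
    rw [show (-1 - (q : ℤ)) + 1 = -(q : ℤ) by ring] at rMC
    have o1 := oS1 P hP
    by_cases hs₁P : s₁ ∈ P
    · ---------------------------------------------------------------- branch `max S ∈ K`
      have hCb' : ∀ c ∈ S \ P, 1 - (q : ℤ) ≤ c ∧ c + 1 ≤ s₁ := by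
        intro c hc
        have h0 := Finset.mem_sdiff.1 hc
        have h1 := hS' c h0.1
        have h2 := hs₁max c h0.1
        have h3 : c ≠ s₁ := fun h' => h0.2 (h' ▸ hs₁P)
        omega
      -- option: `X` keeps `{h} ∪ K`, `Y` gets `{s₁-q} ∪ C`
      have o2' := oRxy (insert h (P.erase s₁)) (by
        rw [hTR]; exact Finset.insert_subset_insert _ (Finset.erase_subset_erase _ hP))
      have e2 : TR \ insert h (P.erase s₁) = S \ P := by
        rw [hTR]; exact sdiff_keep_top₁ hs₁P hnh
      rw [← insert_negq_eq P hs₁P, e2] at o2'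
      -- rows: `E(K; h, ρ)` on `X` (set induction), gap convexity and (M) on `Y`
      have rE := ihS P hPS' h ρ hh hρ0 hρ hPb hPne X
      have rGC := treeBR_gc_insert hq1 Y (C := S \ P) (e := s₁) hs₁.2 hCb'
      have rM : treeBR q Y (S \ P) ≤ treeBR q Y (insert (s₁ - q) (S \ P)) :=
        treeBR_le_of_subset_of_bounds hq1 Y (Finset.subset_insert _ _) (lo := s₁ - (q : ℤ))
          (fun c hc => by
            rcases Finset.mem_insert.1 hc with rfl | hc
            · omega
            · have := hCb' c hc; omega)
      have b := eRowL_top hρ0 hρ1 ht0 hs o1 o2' rE rMC rGC rM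
      linarith only [b]
    · ---------------------------------------------------------------- branch `max S ∉ K ≠ ∅`
      have hs₁C : s₁ ∈ S \ P := Finset.mem_sdiff.2 ⟨hs₁S, hs₁P⟩
      have hPb' : ∀ k ∈ P, h + 1 ≤ k ∧ k + 1 ≤ s₁ := by
        intro k hk
        have h1 := hS k (hP hk)
        have h2 := hs₁max k (hP hk)
        have h3 : k ≠ s₁ := fun h' => hs₁P (h' ▸ hk)
        omega
      have hsub : (S \ P).erase s₁ ⊆ S.erase s₁ := Finset.erase_subset_erase _ Finset.sdiff_subset
      -- options: `Y` keeps `C` (top `s₁ ∈ C`) resp. `{h} ∪ C`, `X` gets `{s₁-q, h} ∪ K` resp. `{s₁-q} ∪ K`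
      have o2' := oRyx ((S \ P).erase s₁) (by rw [hTR]; exact hsub.trans (Finset.subset_insert _ _))
      have e2 : TR \ (S \ P).erase s₁ = insert h P := by
        rw [hTR]; exact sdiff_drop_top₀ hs₁P hP hnh
      rw [Finset.insert_erase hs₁C, e2] at o2'
      have o3' := oRyx (insert h ((S \ P).erase s₁)) (by
        rw [hTR]; exact Finset.insert_subset_insert _ hsub)
      have e3 : TR \ insert h ((S \ P).erase s₁) = P := by
        rw [hTR]; exact sdiff_drop_top₁ hs₁P hP hnh
      rw [← insert_negq_eq (S \ P) hs₁C, e3] at o3'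
      -- rows: `Φ(K; s₁, h, ρ)` on `X` (part 12-2), (MC) and (M) `BR({-q} ∪ C) ≤ BR({h} ∪ C)` on `Y`
      have rPhi := treeBR_phi_level P s₁ h ρ hs₁.2 hh hρ0 hρ hPb' hPne X
      have rM := rowQH Y (S \ P) Finset.sdiff_subset
      have b := eRowL_low hρ0 hρ1 hs o1 o2' o3' rPhi rMC rM
      linarith only [b]
  ------------------------------------------------------------------ assembling the node
  have key := treeBR_node_le_top hq1 A B (e₀ := -1) (T := S) hSm1 hR (fun P hP =>
    ⟨core A B ihA oSab oRab oRba P hP, core B A ihB oSba oRba oRab P hP⟩)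
  rw [p_half, hRdef] at key
  linarith only [key]

/-- **THE TOP-LEVEL `E`-ROWS FOR EVERY CONFIGURATION** (HOME E-SIDE-TOPLEVEL.md THEOREM E = the case
`h = -q`, `ρ = u`; opt's split row `(E_u)(β = ½, B)` for EVERY `B`; `|S| = 1` is R31 = part 10c,
`|S| = 2` is R33 = part 10j-b, `|S| = 3` is part 10l): for a nonempty set `S` of exponents in
`[1-q, -2]` and every tree, `2·BR({-1} ∪ S) ≤ (1-u)·BR({0} ∪ S) + (1+u)·BR({-q} ∪ S)`. -/
theorem treeBR_eRow_all (S : Finset ℤ) (hS : ∀ s ∈ S, 1 - (q : ℤ) ≤ s ∧ s ≤ -2) (hne : S.Nonempty)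
    (t : SumTree) :
    2 * treeBR q t (insert (-1) S) ≤
      (1 - unitRoundoff q) * treeBR q t (insert 0 S) +
        (1 + unitRoundoff q) * treeBR q t (insert (-(q : ℤ)) S) := by
  have hu : unitRoundoff q = (2 : ℚ) ^ (-(q : ℤ)) := unitRoundoff_eq_zpow q
  exact treeBR_eRow_level (q := q) S (-(q : ℤ)) (unitRoundoff q) le_rfl (unitRoundoff_nonneg q)
    (by rw [hu]) (fun s hs => by have := hS s hs; omega) hne t

end ELevel

end Summit.Ventures.CertifiedArithmetic.LowPrec.Opt
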